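import Summits.AtomisticToContinuum.Crystallization.Theorems.GappedShellCensusShellTrichotomyStubTCornerMax
import Summits.AtomisticToContinuum.Crystallization.Theorems.GappedShellCensusFiveFoldRationingRStubFfrLens

/-!
# Crux `GappedShellCensus.TornFree` (stmt-AtomisticToContinuum-18069), line `Sketch` —
# stub `stub_tfSectorWindows`

**Sector windows.**  For a bond `(y, v)` at scale `a` (length in `[0.98a, 1.02a]`) and two common
neighbours `w₁, w₂` of its ends (the four lengths `|y wᵢ|`, `|v wᵢ|` in `[0.98a, 1.02a]`,
`|w₁ w₂| ≥ 0.98a`), the azimuthal angle about the bond between `w₁` and `w₂` — the angle between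
the components `perpTo (v − y) (wᵢ − y)` of `wᵢ − y` orthogonal to `v − y` (Hales's `dih`) — has
cosine `≥ 1/4` when `|w₁ w₂| ≤ 1.02a` (part T, quasi-regular tetrahedron) and cosine `≤ 1/10`
when `|w₁ w₂| ≥ 1.26a` (part W, far pair).  Both are stated multiplicatively.

## Proof

Everything is a function of `V = v − y`, `A = w₁ − y`, `B = w₂ − y`, and both inequalities are
homogeneous of degree two (`perpTo (c • V) (c • A) = c • perpTo V A`), so we translate `y` to the
origin and rescale by `a⁻¹`; the unit-scale statement is `tfsw_sector_unit`.
* Part T is the landed T-corner bound `stub_tCornerMax` (angle `≤ arccos (1/4)`) read through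
  `cos (angle p q) = ⟪p, q⟫ / (‖p‖ ‖q‖)` and the antitonicity of `cos` on `[0, π]`.
* Part W (decoupled bound): with `P_A = ⟪V, A⟫`, `P_B = ⟪V, B⟫`, `D = ‖V‖²`,
  `⟪perpTo V A, perpTo V B⟫ = ⟪A, B⟫ − P_A P_B / D`, where by polarisation
  `⟪A, B⟫ = (‖A‖² + ‖B‖² − |AB|²)/2 ≤ (2 · 1.0404 − 1.5876)/2 = 0.2466`,
  `P_A, P_B ≥ (2 · 0.9604 − 1.0404)/2 = 0.4402` and `D ≤ 1.0404`; hence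
  `⟪perpTo V A, perpTo V B⟫ ≤ 0.2466 − 0.4402²/1.0404 < 0.061 ≤ 0.069`.  On the other side the
  lens arithmetic of the landed `stub_ffrLens` (`ffrLens_q_sq_lower`) gives
  `‖perpTo V A‖², ‖perpTo V B‖² ≥ 0.69`, so `(1/10) ‖perpTo V A‖ ‖perpTo V B‖ ≥ 0.069`.
-/

noncomputable section

namespace Summit.AtomisticToContinuum.Crystallization.Theorems

open scoped RealInnerProductSpace
open Literature.Geometry.DiscreteGeometry

/-! ### Helpers -/

/-- Homogeneity of `perpTo`: `perpTo (c • a) (c • b) = c • perpTo a b` for `c ≠ 0`. -/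
private theorem tfsw_perpTo_smul_smul {c : ℝ} (hc : c ≠ 0) (a b : EuclideanSpace ℝ (Fin 3)) :
    perpTo (c • a) (c • b) = c • perpTo a b := by
  rw [perpTo_def, perpTo_def, smul_sub, smul_smul]
  simp only [real_inner_smul_left, real_inner_smul_right]
  rw [mul_div_mul_left _ _ hc, mul_div_mul_left _ _ hc, smul_smul, mul_comm]

/-- A length in `[0.98, 1.02]` has its square in `[0.9604, 1.0404]`. -/
private theorem tfsw_sq_window {d : ℝ} (h1 : 1 - 1 / 50 ≤ d) (h2 : d ≤ 1 + 1 / 50) :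
    2401 / 2500 ≤ d ^ 2 ∧ d ^ 2 ≤ 2601 / 2500 := by
  have h0 : (0 : ℝ) ≤ 1 - 1 / 50 := by norm_num
  have hd : 0 ≤ d := h0.trans h1
  have hl := mul_le_mul h1 h1 h0 hd
  have hu := mul_le_mul h2 h2 hd (by norm_num)
  constructor <;> nlinarith [hl, hu]

/-- Rescaling a window: `0.98 a ≤ r ≤ 1.02 a` gives `0.98 ≤ a⁻¹ r ≤ 1.02`. -/
private theorem tfsw_window_rescale {a r : ℝ} (ha : 0 < a) (h1 : a * (1 - 1 / 50) ≤ r)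
    (h2 : r ≤ a * (1 + 1 / 50)) : 1 - 1 / 50 ≤ a⁻¹ * r ∧ a⁻¹ * r ≤ 1 + 1 / 50 := by
  rw [inv_mul_eq_div, le_div_iff₀ ha, div_le_iff₀ ha]
  constructor <;> linarith

/-- From `angle p q ≤ arccos (1/4)` to the multiplicative cosine form `‖p‖ ‖q‖ / 4 ≤ ⟪p, q⟫`. -/
private theorem tfsw_quarter_mul_le_inner {p q : EuclideanSpace ℝ (Fin 3)}
    (h : InnerProductGeometry.angle p q ≤ Real.arccos (1 / 4)) :
    1 / 4 * (‖p‖ * ‖q‖) ≤ ⟪p, q⟫ := by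
  have hcos : Real.cos (Real.arccos (1 / 4)) ≤ Real.cos (InnerProductGeometry.angle p q) :=
    Real.cos_le_cos_of_nonneg_of_le_pi (InnerProductGeometry.angle_nonneg _ _)
      (Real.arccos_le_pi _) h
  rw [Real.cos_arccos (by norm_num) (by norm_num), InnerProductGeometry.cos_angle] at hcos
  rcases (mul_nonneg (norm_nonneg p) (norm_nonneg q)).eq_or_lt with h0 | hpos
  · rcases mul_eq_zero.1 h0.symm with hp | hq
    · rw [norm_eq_zero] at hp
      simp [hp]
    · rw [norm_eq_zero] at hq
      simp [hq]
  · rwa [le_div_iff₀ hpos] at hcos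

/-- **Sector windows at unit scale, bond based at the origin.**  For `V, A, B ∈ ℝ³` with
`‖V‖, ‖A‖, ‖B‖, dist V A, dist V B ∈ [0.98, 1.02]` and `dist A B ≥ 0.98`: if `dist A B ≤ 1.02`
then `‖perpTo V A‖ ‖perpTo V B‖ / 4 ≤ ⟪perpTo V A, perpTo V B⟫`, and if `dist A B ≥ 1.26` then
`⟪perpTo V A, perpTo V B⟫ ≤ ‖perpTo V A‖ ‖perpTo V B‖ / 10`. -/
private theorem tfsw_sector_unit (V A B : EuclideanSpace ℝ (Fin 3))
    (hV : 1 - 1 / 50 ≤ ‖V‖ ∧ ‖V‖ ≤ 1 + 1 / 50) (hA : 1 - 1 / 50 ≤ ‖A‖ ∧ ‖A‖ ≤ 1 + 1 / 50)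
    (hB : 1 - 1 / 50 ≤ ‖B‖ ∧ ‖B‖ ≤ 1 + 1 / 50)
    (hVA : 1 - 1 / 50 ≤ dist V A ∧ dist V A ≤ 1 + 1 / 50)
    (hVB : 1 - 1 / 50 ≤ dist V B ∧ dist V B ≤ 1 + 1 / 50) (hAB : 1 - 1 / 50 ≤ dist A B) :
    (dist A B ≤ 1 + 1 / 50 →
        1 / 4 * (‖perpTo V A‖ * ‖perpTo V B‖) ≤ ⟪perpTo V A, perpTo V B⟫) ∧
    (63 / 50 ≤ dist A B →
        ⟪perpTo V A, perpTo V B⟫ ≤ 1 / 10 * (‖perpTo V A‖ * ‖perpTo V B‖)) := by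
  refine ⟨fun hAB2 => tfsw_quarter_mul_le_inner
    (stub_tCornerMax V A B hV hA hB hVA hVB ⟨hAB, hAB2⟩), fun hfar => ?_⟩
  -- Part W: scalars
  have hrv : 0 < ‖V‖ := by linarith [hV.1]
  have hV0 : V ≠ 0 := norm_pos_iff.1 hrv
  have hvv : ⟪V, V⟫ = ‖V‖ ^ 2 := real_inner_self_eq_norm_sq V
  obtain ⟨hd1, hd2⟩ := tfsw_sq_window hV.1 hV.2
  obtain ⟨hsA1, hsA2⟩ := tfsw_sq_window hA.1 hA.2
  obtain ⟨hsB1, hsB2⟩ := tfsw_sq_window hB.1 hB.2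
  obtain ⟨htA1, htA2⟩ := tfsw_sq_window hVA.1 hVA.2
  obtain ⟨htB1, htB2⟩ := tfsw_sq_window hVB.1 hVB.2
  have hD2 : (63 / 50 : ℝ) ^ 2 ≤ dist A B ^ 2 := pow_le_pow_left₀ (by norm_num) hfar 2
  have gva : ⟪V, A⟫ = (‖A‖ ^ 2 + ‖V‖ ^ 2 - dist V A ^ 2) / 2 := by
    rw [dist_eq_norm, norm_sub_sq_real]; ring
  have gvb : ⟪V, B⟫ = (‖B‖ ^ 2 + ‖V‖ ^ 2 - dist V B ^ 2) / 2 := by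
    rw [dist_eq_norm, norm_sub_sq_real]; ring
  have gab : ⟪A, B⟫ = (‖A‖ ^ 2 + ‖B‖ ^ 2 - dist A B ^ 2) / 2 := by
    rw [dist_eq_norm, norm_sub_sq_real]; ring
  have hpq : ⟪perpTo V A, perpTo V B⟫ = ⟪A, B⟫ - ⟪V, A⟫ / ⟪V, V⟫ * ⟪V, B⟫ := by
    conv_lhs => rw [perpTo_def V B]
    rw [inner_sub_right, real_inner_smul_right, inner_perpTo_left, mul_zero, sub_zero,
      perpTo_def, inner_sub_left, real_inner_smul_left]
  have hpp : ‖perpTo V A‖ ^ 2 = ‖A‖ ^ 2 - ⟪V, A⟫ ^ 2 / ‖V‖ ^ 2 := by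
    rw [← real_inner_self_eq_norm_sq (perpTo V A), inner_perpTo_self hV0,
      real_inner_self_eq_norm_sq A, hvv]
  have hqq : ‖perpTo V B‖ ^ 2 = ‖B‖ ^ 2 - ⟪V, B⟫ ^ 2 / ‖V‖ ^ 2 := by
    rw [← real_inner_self_eq_norm_sq (perpTo V B), inner_perpTo_self hV0,
      real_inner_self_eq_norm_sq B, hvv]
  -- lens lower bounds `‖perpTo V A‖², ‖perpTo V B‖² ≥ 0.69`
  have hp2 : 69 / 100 ≤ ‖perpTo V A‖ ^ 2 := by
    have h := ffrLens_q_sq_lower (a := 1) (A := ‖A‖ ^ 2) (B := dist V A ^ 2) (D := ‖V‖ ^ 2)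
      (P := ⟪V, A⟫) one_pos (by linarith) (by linarith) (by linarith) (by linarith) (by linarith)
      (by linarith) gva
    rw [hpp]
    linarith
  have hq2 : 69 / 100 ≤ ‖perpTo V B‖ ^ 2 := by
    have h := ffrLens_q_sq_lower (a := 1) (A := ‖B‖ ^ 2) (B := dist V B ^ 2) (D := ‖V‖ ^ 2)
      (P := ⟪V, B⟫) one_pos (by linarith) (by linarith) (by linarith) (by linarith) (by linarith)
      (by linarith) gvb
    rw [hqq]
    linarith
  have hprod : 69 / 100 ≤ ‖perpTo V A‖ * ‖perpTo V B‖ := by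
    have h2 : (69 / 100 : ℝ) ^ 2 ≤ (‖perpTo V A‖ * ‖perpTo V B‖) ^ 2 := by
      rw [mul_pow]
      calc (69 / 100 : ℝ) ^ 2 = 69 / 100 * (69 / 100) := by norm_num
        _ ≤ ‖perpTo V A‖ ^ 2 * ‖perpTo V B‖ ^ 2 :=
            mul_le_mul hp2 hq2 (by norm_num) (by positivity)
    exact (pow_le_pow_iff_left₀ (by norm_num) (by positivity) two_ne_zero).1 h2
  -- upper bound on the inner product
  have hPA : 4402 / 10000 ≤ ⟪V, A⟫ := by rw [gva]; linarith
  have hPB : 4402 / 10000 ≤ ⟪V, B⟫ := by rw [gvb]; linarith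
  have hABu : ⟪A, B⟫ ≤ 2466 / 10000 := by rw [gab]; norm_num at hD2; linarith
  have hd2pos : 0 < ‖V‖ ^ 2 := by positivity
  have hin : ⟪perpTo V A, perpTo V B⟫ ≤ 69 / 1000 := by
    rw [hpq, hvv]
    have hPP : 4402 / 10000 * (4402 / 10000) ≤ ⟪V, A⟫ * ⟪V, B⟫ :=
      mul_le_mul hPA hPB (by norm_num) (by linarith)
    have hfrac : ⟪A, B⟫ - 69 / 1000 ≤ ⟪V, A⟫ / ‖V‖ ^ 2 * ⟪V, B⟫ := by
      rw [div_mul_eq_mul_div, le_div_iff₀ hd2pos]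
      linarith [mul_nonneg (sub_nonneg.2 hABu) hd2pos.le]
    linarith
  linarith

/-! ### The stub -/

/-- **Stub 4 (sector windows).** For a bond `(y, v)` and two common neighbours `w₁, w₂` (all five
lengths in `[0.98a, 1.02a]`, `|w₁w₂| ≥ 0.98a`), the azimuthal angle about the bond between `w₁`
and `w₂` (the angle of the `perpTo (v − y)` components, Hales's `dih`) has cosine `≥ 1/4`
(angle `≤ arccos (1/4) ≈ 75.5°`) when `w₁w₂` is a bond, and cosine `≤ 1/10`
(angle `≥ arccos (1/10) ≈ 84.3°`) when `|w₁w₂| ≥ 1.26a`; both in multiplicative form. [folklore] -/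
theorem stub_tfSectorWindows :
    ∀ (a : ℝ), 0 < a → ∀ y v w₁ w₂ : EuclideanSpace ℝ (Fin 3),
      a * (1 - 1 / 50) ≤ dist y v → dist y v ≤ a * (1 + 1 / 50) →
      a * (1 - 1 / 50) ≤ dist y w₁ → dist y w₁ ≤ a * (1 + 1 / 50) →
      a * (1 - 1 / 50) ≤ dist v w₁ → dist v w₁ ≤ a * (1 + 1 / 50) →
      a * (1 - 1 / 50) ≤ dist y w₂ → dist y w₂ ≤ a * (1 + 1 / 50) →
      a * (1 - 1 / 50) ≤ dist v w₂ → dist v w₂ ≤ a * (1 + 1 / 50) →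
      a * (1 - 1 / 50) ≤ dist w₁ w₂ →
      (dist w₁ w₂ ≤ a * (1 + 1 / 50) →
          1 / 4 * (‖perpTo (v - y) (w₁ - y)‖ * ‖perpTo (v - y) (w₂ - y)‖) ≤
            ⟪perpTo (v - y) (w₁ - y), perpTo (v - y) (w₂ - y)⟫) ∧
      (a * (63 / 50) ≤ dist w₁ w₂ →
          ⟪perpTo (v - y) (w₁ - y), perpTo (v - y) (w₂ - y)⟫ ≤
            1 / 10 * (‖perpTo (v - y) (w₁ - y)‖ * ‖perpTo (v - y) (w₂ - y)‖)) := by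
  intro a ha y v w₁ w₂ hyv1 hyv2 hyw11 hyw12 hvw11 hvw12 hyw21 hyw22 hvw21 hvw22 hww
  have hc : 0 < a⁻¹ := inv_pos.2 ha
  -- lengths of the translated and rescaled vectors
  have hn : ∀ w : EuclideanSpace ℝ (Fin 3), ‖a⁻¹ • (w - y)‖ = a⁻¹ * dist y w := fun w => by
    rw [norm_smul_of_nonneg hc.le, ← dist_eq_norm, dist_comm w y]
  have hd : ∀ w w' : EuclideanSpace ℝ (Fin 3),
      dist (a⁻¹ • (w - y)) (a⁻¹ • (w' - y)) = a⁻¹ * dist w w' := fun w w' => by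
    rw [dist_smul₀, dist_sub_right, Real.norm_eq_abs, abs_of_pos hc]
  obtain ⟨hT, hW⟩ := tfsw_sector_unit (a⁻¹ • (v - y)) (a⁻¹ • (w₁ - y)) (a⁻¹ • (w₂ - y))
    (by rw [hn]; exact tfsw_window_rescale ha hyv1 hyv2)
    (by rw [hn]; exact tfsw_window_rescale ha hyw11 hyw12)
    (by rw [hn]; exact tfsw_window_rescale ha hyw21 hyw22)
    (by rw [hd]; exact tfsw_window_rescale ha hvw11 hvw12)
    (by rw [hd]; exact tfsw_window_rescale ha hvw21 hvw22)
    (by rw [hd, inv_mul_eq_div, le_div_iff₀ ha]; linarith)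
  rw [hd, tfsw_perpTo_smul_smul hc.ne', tfsw_perpTo_smul_smul hc.ne', norm_smul_of_nonneg hc.le,
    norm_smul_of_nonneg hc.le, real_inner_smul_left, real_inner_smul_right] at hT hW
  have hc2 : 0 < a⁻¹ * a⁻¹ := mul_pos hc hc
  constructor
  · intro h
    have h' : a⁻¹ * dist w₁ w₂ ≤ 1 + 1 / 50 := by
      rw [inv_mul_eq_div, div_le_iff₀ ha]; linarith
    refine le_of_mul_le_mul_left ?_ hc2
    calc a⁻¹ * a⁻¹ * (1 / 4 * (‖perpTo (v - y) (w₁ - y)‖ * ‖perpTo (v - y) (w₂ - y)‖))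
        = 1 / 4 * (a⁻¹ * ‖perpTo (v - y) (w₁ - y)‖ * (a⁻¹ * ‖perpTo (v - y) (w₂ - y)‖)) := by
          ring
      _ ≤ a⁻¹ * (a⁻¹ * ⟪perpTo (v - y) (w₁ - y), perpTo (v - y) (w₂ - y)⟫) := hT h'
      _ = a⁻¹ * a⁻¹ * ⟪perpTo (v - y) (w₁ - y), perpTo (v - y) (w₂ - y)⟫ := by ring
  · intro h
    have h' : 63 / 50 ≤ a⁻¹ * dist w₁ w₂ := by
      rw [inv_mul_eq_div, le_div_iff₀ ha]; linarith
    refine le_of_mul_le_mul_left ?_ hc2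
    calc a⁻¹ * a⁻¹ * ⟪perpTo (v - y) (w₁ - y), perpTo (v - y) (w₂ - y)⟫
        = a⁻¹ * (a⁻¹ * ⟪perpTo (v - y) (w₁ - y), perpTo (v - y) (w₂ - y)⟫) := by ring
      _ ≤ 1 / 10 * (a⁻¹ * ‖perpTo (v - y) (w₁ - y)‖ * (a⁻¹ * ‖perpTo (v - y) (w₂ - y)‖)) :=
          hW h'
      _ = a⁻¹ * a⁻¹ * (1 / 10 * (‖perpTo (v - y) (w₁ - y)‖ * ‖perpTo (v - y) (w₂ - y)‖)) := by
          ring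

end Summit.AtomisticToContinuum.Crystallization.Theorems

end
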